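import Mathlib
import HarnessLib
import Literature.MathematicalPhysics.QuantumFieldTheory.ConstructiveQFTWave0
import Summits.Ventures.LatticeQCDFlow.Scaling.LatticePeeling
import Summits.Ventures.LatticeQCDFlow.Exactness.CompactHaar

/-!
# LatticeQCDFlow / Scaling — two dimensions: the plaquettes off one puncture are INDEPENDENT HAAR variables; the 2-d partition function up to one plaquette

HONEST FRAMING: exact (Metropolis-corrected) sampling algorithms for lattice gauge theory; figures of merit are
autocorrelation/cost numbers at stated couplings and volumes; no continuum-physics claim.

Venture `LatticeQCDFlow` (cell pub-lqcd), topic `Scaling`, FANOUT row 30 (lean-1) — OUR WORK, the structural half of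
the EXPLICIT `U(1)` tunnelling law in `d = 2` (the volumes of STEP-0): theory-2's laws (`Scaling/FluxTunnelling.lean`,
`Scaling/SparsePatchSectorsLattice.lean`) price every sector change of an exact local sampler by the Gibbs mass of a
thick-plaquette event, which enters there as a hypothesis (`η`, `M`).  In two dimensions that mass is computable
because of the following folklore fact (Migdal 1975 and Gross–Witten 1980 use it with free boundary conditions),
proved here on the PERIODIC lattice `(ℤ/L)²`, `L ≥ 2`, for every compact second-countable group `G`:

* `lintegral_prod_plaquette_eq` — for every site `x₀` (the PUNCTURE), every finite set `T ∌ x₀` of plaquettes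
  (= sites in `d = 2`) and all measurable `F_x : G → [0,∞]`: `∫ ∏_{x ∈ T} F_x(U_x) dHaar^{⊗E} = ∏_{x ∈ T} ∫ F_x dHaar`;
* `map_plaquettes_eq_pi` — equivalently, under product Haar measure on the links the holonomies `(U_x)_{x ≠ x₀}`
  are INDEPENDENT and HAAR DISTRIBUTED (joint law `= Haar^{⊗(Λ ∖ x₀)}`);
* `lintegral_prod_weight_erase` — the Wilson weight with the plaquette `x₀` switched off integrates to
  `z₁(β)^{L²−1}` (`z₁` of `Scaling/LatticePeeling.lean`); `partitionFunction_two_le` / `le_partitionFunction_two` —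
  for `β ≥ 0`, `Re tr ρ ≤ N` and plaquette actions `≤ s`: `e^{−βs}·z₁(β)^{L²−1} ≤ Z_Λ(β) ≤ z₁(β)^{L²−1}`, i.e. in two
  dimensions the free energy is that of independent plaquettes up to ONE plaquette weight (the tree's peeling /
  tree-gauge sandwich leaves `O(L)` plaquettes of slack in `d = 2`).

PROOF (no gauge fixing): order the sites `x ≠ x₀` by the rank `a + L·b` of their coordinates `(a, b)` relative to
`x₀`; the PRIVATE link of `x` is its left link `(x, 1)` on the row `b = 0` and its bottom link `(x, 0)` on the rows
`b ≥ 1`.  Each link of the 2-torus lies in exactly two plaquettes, and the second plaquette through the private link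
of `x` (`x − e₀`, resp. `x − e₁`) has SMALLER rank; so, removing from `T` its plaquette of minimal rank
(`Finset.induction_on_min_value`), the private link occurs in no other factor, and integrating that one link
(`lmarginal` over a singleton) turns `F_x(U_x) = F_x(g·B)` (resp. `F_x(A·g⁻¹)`) into the constant `∫ F_x dHaar` by
right invariance (resp. inversion and left invariance) of the Haar measure of a compact group
(`Exactness/CompactHaar.lean`).  Elementary; nothing is cited as a fact; no `def`.
-/

noncomputable section

namespace Summit.Ventures.LatticeQCDFlow.Theory2.Lattice.TwoDim

open MeasureTheory Literature.MathematicalPhysics.QuantumFieldTheory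
open scoped ENNReal
variable {L : ℕ} {G : Type*} [Group G]

/-! ## §1. Plaquette bookkeeping on `(ℤ/L)²` -/

/-- Updating a link that is none of the four links of the plaquette at `p` does not change its
holonomy. [folklore] -/
theorem plaquetteHolonomy_update_of_ne {U : GaugeConfig 2 L G} {e : Edge 2 L} {p : Site 2 L} (g : G)
    (h1 : ((p, 0) : Edge 2 L) ≠ e) (h2 : ((p.shift 0, 1) : Edge 2 L) ≠ e)
    (h3 : ((p.shift 1, 0) : Edge 2 L) ≠ e) (h4 : ((p, 1) : Edge 2 L) ≠ e) :
    plaquetteHolonomy (Function.update U e g) p 0 1 = plaquetteHolonomy U p 0 1 := by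
  unfold plaquetteHolonomy
  rw [Function.update_of_ne h1, Function.update_of_ne h2, Function.update_of_ne h3,
    Function.update_of_ne h4]

/-- A horizontal link `(y, 0)` belongs only to the plaquettes at `y` (bottom link) and at `y − e₁`
(top link): updating it leaves every other plaquette unchanged. [folklore] -/
theorem plaquetteHolonomy_update_horiz {U : GaugeConfig 2 L G} {y p : Site 2 L} (g : G)
    (h1 : p ≠ y) (h2 : p.shift 1 ≠ y) :
    plaquetteHolonomy (Function.update U (y, 0) g) p 0 1 = plaquetteHolonomy U p 0 1 :=
  plaquetteHolonomy_update_of_ne g (fun h => h1 (congrArg Prod.fst h))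
    (fun h => one_ne_zero (congrArg Prod.snd h))
    (fun h => h2 (congrArg Prod.fst h))
    (fun h => one_ne_zero (congrArg Prod.snd h))

/-- A vertical link `(y, 1)` belongs only to the plaquettes at `y` (left link) and at `y − e₀`
(right link). [folklore] -/
theorem plaquetteHolonomy_update_vert {U : GaugeConfig 2 L G} {y p : Site 2 L} (g : G)
    (h1 : p ≠ y) (h2 : p.shift 0 ≠ y) :
    plaquetteHolonomy (Function.update U (y, 1) g) p 0 1 = plaquetteHolonomy U p 0 1 :=
  plaquetteHolonomy_update_of_ne g (fun h => zero_ne_one (congrArg Prod.snd h))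
    (fun h => h2 (congrArg Prod.fst h))
    (fun h => zero_ne_one (congrArg Prod.snd h))
    (fun h => h1 (congrArg Prod.fst h))

/-- The holonomy at `q` after updating its bottom link `(q, 0)` to `g`: `g · U(q+e₀,1) · U(q+e₁,0)⁻¹ ·
U(q,1)⁻¹` (`L ≥ 2`, so the four links are distinct). [folklore] -/
theorem plaquetteHolonomy_update_bottom [NeZero L] (hL : 2 ≤ L) (U : GaugeConfig 2 L G)
    (q : Site 2 L) (g : G) :
    plaquetteHolonomy (Function.update U (q, 0) g) q 0 1 =
      g * U (q.shift 0, 1) * (U (q.shift 1, 0))⁻¹ * (U (q, 1))⁻¹ := by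
  unfold plaquetteHolonomy
  rw [Function.update_self,
    Function.update_of_ne (show ((q.shift 0, 1) : Edge 2 L) ≠ (q, 0) from fun h => one_ne_zero (congrArg Prod.snd h)),
    Function.update_of_ne (show ((q.shift 1, 0) : Edge 2 L) ≠ (q, 0) from fun h => shift_ne_self hL q 1 (congrArg Prod.fst h)),
    Function.update_of_ne (show ((q, 1) : Edge 2 L) ≠ (q, 0) from fun h => one_ne_zero (congrArg Prod.snd h))]

/-- The holonomy at `q` after updating its left link `(q, 1)` to `g`: `U(q,0) · U(q+e₀,1) ·
U(q+e₁,0)⁻¹ · g⁻¹`. [folklore] -/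
theorem plaquetteHolonomy_update_left [NeZero L] (hL : 2 ≤ L) (U : GaugeConfig 2 L G)
    (q : Site 2 L) (g : G) :
    plaquetteHolonomy (Function.update U (q, 1) g) q 0 1 =
      U (q, 0) * U (q.shift 0, 1) * (U (q.shift 1, 0))⁻¹ * g⁻¹ := by
  unfold plaquetteHolonomy
  rw [Function.update_self,
    Function.update_of_ne (show ((q, 0) : Edge 2 L) ≠ (q, 1) from fun h => zero_ne_one (congrArg Prod.snd h)),
    Function.update_of_ne (show ((q.shift 0, 1) : Edge 2 L) ≠ (q, 1) from fun h => shift_ne_self hL q 0 (congrArg Prod.fst h)),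
    Function.update_of_ne (show ((q.shift 1, 0) : Edge 2 L) ≠ (q, 1) from fun h => zero_ne_one (congrArg Prod.snd h))]

/-- In `ZMod L`, stepping down from a non-zero residue lowers the representative:
`(z − 1).val < z.val` for `z ≠ 0`. [folklore] -/
theorem val_sub_one_lt [NeZero L] (hL : 2 ≤ L) {z : ZMod L} (hz : z ≠ 0) :
    (z - 1).val < z.val := by
  haveI : Fact (1 < L) := ⟨hL⟩
  have hv : z.val = ((z - 1).val + 1) % L := by
    conv_lhs => rw [← sub_add_cancel z 1]; rw [ZMod.val_add, ZMod.val_one]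
  by_cases hlt : (z - 1).val + 1 < L
  · rw [Nat.mod_eq_of_lt hlt] at hv; omega
  · have hle : (z - 1).val < L := ZMod.val_lt _
    have heq : (z - 1).val + 1 = L := by omega
    rw [heq, Nat.mod_self] at hv
    exact absurd ((ZMod.val_eq_zero z).mp hv) hz

/-- Relative rank on the row through the puncture: the plaquette `q − e₀` precedes `q`. [folklore] -/
theorem rank_sub_single_zero_lt [NeZero L] (hL : 2 ≤ L) {x₀ q : Site 2 L} (hq : q ≠ x₀)
    (hb : q 1 = x₀ 1) :
    ((q - (Pi.single 0 1 : Site 2 L)) 0 - x₀ 0).val + L * ((q - (Pi.single 0 1 : Site 2 L)) 1 - x₀ 1).val <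
      (q 0 - x₀ 0).val + L * (q 1 - x₀ 1).val := by
  have hz : q 0 - x₀ 0 ≠ 0 := by
    refine fun h => hq (funext fun i => ?_)
    fin_cases i
    exacts [sub_eq_zero.mp h, hb]
  have h0 : (q - (Pi.single 0 1 : Site 2 L)) 0 - x₀ 0 = (q 0 - x₀ 0) - 1 := by
    simp only [Pi.sub_apply, Pi.single_eq_same]; ring
  have h1 : (q - (Pi.single 0 1 : Site 2 L)) 1 - x₀ 1 = q 1 - x₀ 1 := by
    simp only [Pi.sub_apply, Pi.single_eq_of_ne (show (1 : Fin 2) ≠ 0 by decide), sub_zero]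
  rw [h0, h1]
  have := val_sub_one_lt hL hz
  omega

/-- Relative rank off that row: the plaquette `q − e₁` precedes `q`. [folklore] -/
theorem rank_sub_single_one_lt [NeZero L] (hL : 2 ≤ L) {x₀ q : Site 2 L} (hb : q 1 ≠ x₀ 1) :
    ((q - (Pi.single 1 1 : Site 2 L)) 0 - x₀ 0).val + L * ((q - (Pi.single 1 1 : Site 2 L)) 1 - x₀ 1).val <
      (q 0 - x₀ 0).val + L * (q 1 - x₀ 1).val := by
  have hz : q 1 - x₀ 1 ≠ 0 := fun h => hb (sub_eq_zero.mp h)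
  have h0 : (q - (Pi.single 1 1 : Site 2 L)) 0 - x₀ 0 = q 0 - x₀ 0 := by
    simp only [Pi.sub_apply, Pi.single_eq_of_ne (show (0 : Fin 2) ≠ 1 by decide), sub_zero]
  have h1 : (q - (Pi.single 1 1 : Site 2 L)) 1 - x₀ 1 = (q 1 - x₀ 1) - 1 := by
    simp only [Pi.sub_apply, Pi.single_eq_same]; ring
  rw [h0, h1]
  have := Nat.mul_lt_mul_of_pos_left (val_sub_one_lt hL hz) (show 0 < L by omega)
  omega

/-! ## §2. Independence of the plaquettes off the puncture -/

section Haar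

variable [TopologicalSpace G] [IsTopologicalGroup G] [CompactSpace G] [SecondCountableTopology G]
  [MeasurableSpace G] [BorelSpace G]

omit [CompactSpace G] in
/-- The plaquette holonomy is a continuous (hence measurable) function of the links. [folklore] -/
theorem measurable_plaquetteHolonomy [NeZero L] (x : Site 2 L) :
    Measurable fun U : GaugeConfig 2 L G => plaquetteHolonomy U x 0 1 := by
  have hc : Continuous fun U : GaugeConfig 2 L G => plaquetteHolonomy U x 0 1 := by
    unfold plaquetteHolonomy; fun_prop
  exact hc.measurable

/-- **Independence of the plaquettes off one puncture (product form).**  On `(ℤ/L)²`, `L ≥ 2`, for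
every site `x₀`, every finite set `T ∌ x₀` of sites and all measurable `F_x : G → [0,∞]`:
`∫ ∏_{x ∈ T} F_x(U_x) dHaar^{⊗E} = ∏_{x ∈ T} ∫ F_x dHaar`. [folklore] -/
theorem lintegral_prod_plaquette_eq [NeZero L] (hL : 2 ≤ L) (x₀ : Site 2 L)
    (F : Site 2 L → G → ℝ≥0∞) (hF : ∀ x, Measurable (F x)) (T : Finset (Site 2 L))
    (hT : x₀ ∉ T) :
    ∫⁻ U, ∏ x ∈ T, F x (plaquetteHolonomy U x 0 1)
        ∂(Measure.pi fun _ : Edge 2 L => haarProbability G) =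
      ∏ x ∈ T, ∫⁻ g, F x g ∂(haarProbability G) := by
  classical
  revert hT
  refine Finset.induction_on_min_value
    (fun x : Site 2 L => (x 0 - x₀ 0).val + L * (x 1 - x₀ 1).val) T ?_ ?_
  · intro; simp
  · intro q s hqs hmin ih hins
    have hq0 : q ≠ x₀ := fun h => hins (h ▸ Finset.mem_insert_self q s)
    have hs : x₀ ∉ s := fun h => hins (Finset.mem_insert_of_mem h)
    have hmeasF : ∀ x, Measurable fun U : GaugeConfig 2 L G => F x (plaquetteHolonomy U x 0 1) :=
      fun x => (hF x).comp (measurable_plaquetteHolonomy x)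
    have hPs : Measurable fun U : GaugeConfig 2 L G =>
        ∏ x ∈ s, F x (plaquetteHolonomy U x 0 1) :=
      Finset.measurable_prod s fun x _ => hmeasF x
    -- the private link `e` of `q`: no other plaquette of `s` contains it, and Haar-averaging it
    -- averages `F q` over the whole group
    obtain ⟨e, hind, hkey⟩ : ∃ e : Edge 2 L,
        (∀ (U : GaugeConfig 2 L G) (g : G), ∏ x ∈ s, F x (plaquetteHolonomy (Function.update U e g) x 0 1)
            = ∏ x ∈ s, F x (plaquetteHolonomy U x 0 1)) ∧
        (∀ U : GaugeConfig 2 L G, ∫⁻ g, F q (plaquetteHolonomy (Function.update U e g) q 0 1)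
            ∂(haarProbability G) = ∫⁻ g, F q g ∂(haarProbability G)) := by
      by_cases hb : q 1 = x₀ 1
      · -- row through the puncture: private link = left link `(q, 1)`, shared with `q − e₀`
        refine ⟨(q, 1), fun U g => Finset.prod_congr rfl fun x hx => ?_, fun U => ?_⟩
        · have hxq : x ≠ q := fun h => hqs (h ▸ hx)
          have hx2 : x.shift 0 ≠ q := by
            intro h
            have hx' : x = q - (Pi.single 0 1 : Site 2 L) := by rw [← h]; simp [Site.shift]
            have hle := hmin x hx
            rw [hx'] at hle
            exact absurd (rank_sub_single_zero_lt hL hq0 hb) (not_lt.mpr hle)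
          rw [plaquetteHolonomy_update_vert g hxq hx2]
        · simp_rw [plaquetteHolonomy_update_left hL U q]
          rw [lintegral_inv_eq_self (μ := haarProbability G)
            (fun g => F q (U (q, 0) * U (q.shift 0, 1) * (U (q.shift 1, 0))⁻¹ * g))]
          exact lintegral_mul_left_eq_self _ _
      · -- other rows: private link = bottom link `(q, 0)`, shared with `q − e₁`
        refine ⟨(q, 0), fun U g => Finset.prod_congr rfl fun x hx => ?_, fun U => ?_⟩
        · have hxq : x ≠ q := fun h => hqs (h ▸ hx)
          have hx2 : x.shift 1 ≠ q := by
            intro h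
            have hx' : x = q - (Pi.single 1 1 : Site 2 L) := by rw [← h]; simp [Site.shift]
            have hle := hmin x hx
            rw [hx'] at hle
            exact absurd (rank_sub_single_one_lt hL (x₀ := x₀) hb) (not_lt.mpr hle)
          rw [plaquetteHolonomy_update_horiz g hxq hx2]
        · simp_rw [plaquetteHolonomy_update_bottom hL U q, mul_assoc]
          exact lintegral_mul_right_eq_self (fun g => F q g) _
    have key : ∫⁻ U, F q (plaquetteHolonomy U q 0 1) * ∏ x ∈ s, F x (plaquetteHolonomy U x 0 1)
          ∂(Measure.pi fun _ : Edge 2 L => haarProbability G)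
        = ∫⁻ U, (∫⁻ g, F q g ∂(haarProbability G)) * ∏ x ∈ s, F x (plaquetteHolonomy U x 0 1)
          ∂(Measure.pi fun _ : Edge 2 L => haarProbability G) := by
      refine lintegral_eq_of_lmarginal_eq {e} ((hmeasF q).mul hPs) (measurable_const.mul hPs) ?_
      rw [lmarginal_singleton, lmarginal_singleton]
      funext U
      simp_rw [hind]
      have hmu : Measurable fun g : G => F q (plaquetteHolonomy (Function.update U e g) q 0 1) :=
        (hmeasF q).comp (measurable_update U)
      rw [lintegral_mul_const _ hmu, lintegral_const, measure_univ, mul_one, hkey U]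
    rw [Finset.prod_insert hqs, ← ih hs, ← lintegral_const_mul _ hPs, ← key]
    simp_rw [Finset.prod_insert hqs]

/-- **Independence of the plaquettes off one puncture (law form).**  Under product Haar measure on
the links of `(ℤ/L)²`, `L ≥ 2`, the plaquette holonomies at the sites `x ≠ x₀` are independent and
Haar distributed: their joint law is the product Haar measure. [folklore] -/
theorem map_plaquettes_eq_pi [NeZero L] (hL : 2 ≤ L) (x₀ : Site 2 L) :
    (Measure.pi fun _ : Edge 2 L => haarProbability G).map
        (fun (U : GaugeConfig 2 L G) (x : {x : Site 2 L // x ≠ x₀}) => plaquetteHolonomy U x.1 0 1) =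
      Measure.pi fun _ : {x : Site 2 L // x ≠ x₀} => haarProbability G := by
  classical
  have hmeas : Measurable fun (U : GaugeConfig 2 L G) (x : {x : Site 2 L // x ≠ x₀}) =>
      plaquetteHolonomy U x.1 0 1 :=
    measurable_pi_lambda _ fun x => measurable_plaquetteHolonomy x.1
  symm
  refine Measure.pi_eq fun s hs => ?_
  rw [Measure.map_apply hmeas (MeasurableSet.univ_pi hs)]
  -- the preimage of the box is `{U | ∀ x ≠ x₀, U_x ∈ s x}`; its measure is a product integral
  let F : Site 2 L → G → ℝ≥0∞ := fun x g =>
    if h : x ≠ x₀ then (s ⟨x, h⟩).indicator 1 g else 1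
  have hF : ∀ x, Measurable (F x) := by
    intro x
    by_cases h : x ≠ x₀
    · simp only [F, dif_pos h]; exact measurable_one.indicator (hs ⟨x, h⟩)
    · simp only [F, dif_neg h]; exact measurable_const
  have hset : (fun (U : GaugeConfig 2 L G) (x : {x : Site 2 L // x ≠ x₀}) =>
        plaquetteHolonomy U x.1 0 1) ⁻¹' (Set.univ.pi s) =
      {U | ∀ x : {x : Site 2 L // x ≠ x₀}, plaquetteHolonomy U x.1 0 1 ∈ s x} := by
    ext U; simp
  have hmS : MeasurableSet
      {U : GaugeConfig 2 L G | ∀ x : {x : Site 2 L // x ≠ x₀}, plaquetteHolonomy U x.1 0 1 ∈ s x} := by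
    rw [← hset]; exact hmeas (MeasurableSet.univ_pi hs)
  set S : Set (GaugeConfig 2 L G) := {U : GaugeConfig 2 L G | ∀ x : {x : Site 2 L // x ≠ x₀},
    plaquetteHolonomy U x.1 0 1 ∈ s x} with hSdef
  have hind : ∀ U : GaugeConfig 2 L G,
      (∏ x ∈ Finset.univ.erase x₀, F x (plaquetteHolonomy U x 0 1)) = S.indicator 1 U := by
    intro U
    by_cases hU : ∀ x : {x : Site 2 L // x ≠ x₀}, plaquetteHolonomy U x.1 0 1 ∈ s x
    · rw [Set.indicator_of_mem (show U ∈ S from hU), Pi.one_apply]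
      refine Finset.prod_eq_one fun x hx => ?_
      have hx : x ≠ x₀ := Finset.ne_of_mem_erase hx
      simp only [F, dif_pos hx]
      rw [Set.indicator_of_mem (hU ⟨x, hx⟩), Pi.one_apply]
    · rw [Set.indicator_of_notMem (show U ∉ S from hU)]
      push Not at hU
      obtain ⟨x, hx⟩ := hU
      refine Finset.prod_eq_zero (Finset.mem_erase.mpr ⟨x.2, Finset.mem_univ _⟩) ?_
      simp only [F, dif_pos x.2]
      rw [Set.indicator_of_notMem hx]
  rw [hset, ← lintegral_indicator_one hmS]
  calc ∫⁻ U, S.indicator 1 U ∂(Measure.pi fun _ : Edge 2 L => haarProbability G)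
      = ∫⁻ U, ∏ x ∈ Finset.univ.erase x₀, F x (plaquetteHolonomy U x 0 1)
          ∂(Measure.pi fun _ : Edge 2 L => haarProbability G) :=
        lintegral_congr fun U => (hind U).symm
    _ = ∏ x ∈ Finset.univ.erase x₀, ∫⁻ g, F x g ∂(haarProbability G) :=
        lintegral_prod_plaquette_eq hL x₀ F hF _ (Finset.notMem_erase x₀ _)
    _ = ∏ x : {x : Site 2 L // x ≠ x₀}, ∫⁻ g, F x.1 g ∂(haarProbability G) :=
        Finset.prod_subtype (Finset.univ.erase x₀) (p := fun x => x ≠ x₀) (fun x => by simp) _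
    _ = ∏ x : {x : Site 2 L // x ≠ x₀}, haarProbability G (s x) := by
        refine Finset.prod_congr rfl fun x _ => ?_
        simp only [F, dif_pos x.2]
        exact lintegral_indicator_one (hs x)

end Haar


/-! ## §3. The two-dimensional Wilson weight up to one plaquette -/

section Wilson

variable {N : ℕ} [TopologicalSpace G] [IsTopologicalGroup G] [CompactSpace G]
  [SecondCountableTopology G] [MeasurableSpace G] [BorelSpace G]
  (ρ : G →* Matrix (Fin N) (Fin N) ℂ)

omit [Group G] [TopologicalSpace G] [IsTopologicalGroup G] [CompactSpace G]
  [SecondCountableTopology G] [MeasurableSpace G] [BorelSpace G] in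
/-- In two dimensions the only coordinate plane is `(0, 1)`. [folklore] -/
theorem plane_eq_zero_one (p : {p : Fin 2 × Fin 2 // p.1 < p.2}) :
    p = ⟨((0 : Fin 2), (1 : Fin 2)), by decide⟩ := by
  obtain ⟨⟨i, j⟩, hij⟩ := p
  fin_cases i <;> fin_cases j
  all_goals first | rfl | exact absurd hij (by decide)

omit [TopologicalSpace G] [IsTopologicalGroup G] [CompactSpace G] [SecondCountableTopology G]
  [MeasurableSpace G] [BorelSpace G] in
/-- The Wilson weight of `(ℤ/L)²` is the product over the sites of the one-plaquette weights of the
`(0,1)`-holonomies. [folklore] -/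
theorem weight_eq_prod_two [NeZero L] (β : ℝ) (U : GaugeConfig 2 L G) :
    ENNReal.ofReal (Real.exp (-β * wilsonAction ρ U)) =
      ∏ x : Site 2 L, ENNReal.ofReal
        (Real.exp (-(β * ((N : ℝ) - (ρ (plaquetteHolonomy U x 0 1)).trace.re)))) := by
  rw [wilsonAction_eq_sum_plaqAction,
    show -β * ∑ p, plaqAction ρ U p = ∑ p, -(β * plaqAction ρ U p) by
      rw [neg_mul, Finset.mul_sum, Finset.sum_neg_distrib],
    Real.exp_sum, ENNReal.ofReal_prod_of_nonneg (fun _ _ => (Real.exp_pos _).le)]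
  let e : Plaquette 2 L ≃ Site 2 L :=
    { toFun := fun p => p.1
      invFun := fun x => (x, ⟨((0 : Fin 2), (1 : Fin 2)), by decide⟩)
      left_inv := fun p => Prod.ext rfl (plane_eq_zero_one p.2).symm
      right_inv := fun _ => rfl }
  refine Fintype.prod_equiv e _ _ fun p => ?_
  obtain ⟨x, q⟩ := p
  rw [plane_eq_zero_one q]
  rfl

omit [IsTopologicalGroup G] [CompactSpace G] [SecondCountableTopology G] in
/-- The one-plaquette weight `g ↦ e^{−β(N − Re tr ρ g)}` is measurable (continuous `ρ`). [folklore] -/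
theorem measurable_oneWeight (hρ : Continuous (ρ : G → Matrix (Fin N) (Fin N) ℂ)) (β : ℝ) :
    Measurable fun g : G => ENNReal.ofReal (Real.exp (-(β * ((N : ℝ) - (ρ g).trace.re)))) := by
  have h2 : Continuous fun g : G => (ρ g).trace.re := Complex.continuous_re.comp hρ.matrix_trace
  have hc : Continuous fun g : G => Real.exp (-(β * ((N : ℝ) - (ρ g).trace.re))) := by fun_prop
  exact hc.measurable.ennreal_ofReal

/-- **Punctured partition function.**  Switching off the weight of one plaquette `x₀` of `(ℤ/L)²`
(`L ≥ 2`), the remaining Wilson weight integrates EXACTLY to `z₁(β)^{L²−1}`. [folklore] -/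
theorem lintegral_prod_weight_erase [NeZero L] (hL : 2 ≤ L) (x₀ : Site 2 L)
    (hρ : Continuous (ρ : G → Matrix (Fin N) (Fin N) ℂ)) (β : ℝ) :
    ∫⁻ U, ∏ x ∈ Finset.univ.erase x₀,
        ENNReal.ofReal (Real.exp (-(β * ((N : ℝ) - (ρ (plaquetteHolonomy U x 0 1)).trace.re))))
        ∂(Measure.pi fun _ : Edge 2 L => haarProbability G) = z1 ρ β ^ (L ^ 2 - 1) := by
  rw [lintegral_prod_plaquette_eq hL x₀ (fun _ g =>
      ENNReal.ofReal (Real.exp (-(β * ((N : ℝ) - (ρ g).trace.re))))) (fun _ => measurable_oneWeight ρ hρ β)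
      _ (Finset.notMem_erase x₀ _), Finset.prod_const, Finset.card_erase_of_mem (Finset.mem_univ _),
    Finset.card_univ, Fintype.card_fun, ZMod.card, Fintype.card_fin]
  rfl

/-- **2-d upper bound** `Z_Λ(β) ≤ z₁(β)^{L²−1}` for `β ≥ 0`, `Re tr ρ ≤ N` (drop the weight of one
plaquette, which is `≤ 1`). [folklore] -/
theorem partitionFunction_two_le [NeZero L] (hL : 2 ≤ L)
    (hρ : Continuous (ρ : G → Matrix (Fin N) (Fin N) ℂ)) (htr : ∀ g, (ρ g).trace.re ≤ N)
    {β : ℝ} (hβ : 0 ≤ β) :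
    partitionFunction (d := 2) (L := L) ρ β ≤ z1 ρ β ^ (L ^ 2 - 1) := by
  unfold partitionFunction wilsonWeight
  rw [withDensity_apply _ MeasurableSet.univ, Measure.restrict_univ,
    ← lintegral_prod_weight_erase ρ hL 0 hρ β]
  refine lintegral_mono fun U => ?_
  rw [weight_eq_prod_two ρ β U, ← Finset.prod_erase_mul _ _ (Finset.mem_univ (0 : Site 2 L))]
  have h1 : ENNReal.ofReal (Real.exp (-(β * ((N : ℝ) -
      (ρ (plaquetteHolonomy U 0 0 1)).trace.re)))) ≤ 1 :=
    ENNReal.ofReal_le_one.mpr (Real.exp_le_one_iff.mpr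
      (neg_nonpos.mpr (mul_nonneg hβ (sub_nonneg.mpr (htr _)))))
  calc _ ≤ (∏ x ∈ Finset.univ.erase (0 : Site 2 L), ENNReal.ofReal
          (Real.exp (-(β * ((N : ℝ) - (ρ (plaquetteHolonomy U x 0 1)).trace.re))))) * 1 := by
        gcongr
    _ = _ := mul_one _

/-- **2-d lower bound** `e^{−βs}·z₁(β)^{L²−1} ≤ Z_Λ(β)` for `β ≥ 0` whenever every plaquette action is
`≤ s` (keep the weight of the punctured plaquette, which is `≥ e^{−βs}`). With the upper bound: in
two dimensions `Z_Λ(β)` is `z₁(β)^{L²−1}` up to ONE plaquette weight, for every `L ≥ 2`. [folklore] -/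
theorem le_partitionFunction_two [NeZero L] (hL : 2 ≤ L)
    (hρ : Continuous (ρ : G → Matrix (Fin N) (Fin N) ℂ)) {β s : ℝ}
    (hs : ∀ g, (N : ℝ) - (ρ g).trace.re ≤ s) (hβ : 0 ≤ β) :
    ENNReal.ofReal (Real.exp (-(β * s))) * z1 ρ β ^ (L ^ 2 - 1) ≤
      partitionFunction (d := 2) (L := L) ρ β := by
  have hP : Measurable fun U : GaugeConfig 2 L G => ∏ x ∈ Finset.univ.erase (0 : Site 2 L),
      ENNReal.ofReal (Real.exp (-(β * ((N : ℝ) - (ρ (plaquetteHolonomy U x 0 1)).trace.re)))) :=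
    Finset.measurable_prod _ fun x _ =>
      (measurable_oneWeight ρ hρ β).comp (measurable_plaquetteHolonomy x)
  unfold partitionFunction wilsonWeight
  rw [withDensity_apply _ MeasurableSet.univ, Measure.restrict_univ,
    ← lintegral_prod_weight_erase ρ hL 0 hρ β, ← lintegral_const_mul _ hP]
  refine lintegral_mono fun U => ?_
  rw [weight_eq_prod_two ρ β U, ← Finset.prod_erase_mul _ _ (Finset.mem_univ (0 : Site 2 L)),
    mul_comm]
  gcongr
  exact hs _

end Wilson

end Summit.Ventures.LatticeQCDFlow.Theory2.Lattice.TwoDim
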